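import Summits.HubbardSuperconductivity.HubbardLadder.ObservableWindowSingletAbstract
import Literature.Probability.LatticeModels.TorusBipartite
import HarnessLib

/-!
# R2 soundness — singlet rows on the even torus (part 2: `(ℤ/Lℤ)^d`, `2 ∣ L`, and the `m_s²(L)` rows)

Cell `pub-hubbard`, seat R2 (generation 3). HONEST FRAMING: ladder R1–R4 with certified numbers;
no claim on H/H₀. Part 2 of 2: discharges the graph hypotheses of the Lieb–Mattis singlet rows of
`ObservableWindowSingletAbstract` for the even torus and states the rows the cell's Heisenberg
certificates use.

* **§3 The even torus** — now the Literature file `Literature/Probability/LatticeModels/TorusBipartite.lean`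
  (moved there at the reviewer's request, p200204; statements unchanged): `(ℤ/Lℤ)^d` is connected
  (`torusGraph_connected_of_proj`), bipartite in the parity sublattices when `2 ∣ L`
  (`torusSiteParity`, `evenSublattice`, `torusGraph_isBipartiteWith_evenSublattice`) and the two
  classes are equinumerous (`card_compl_evenSublattice`, via `x ↦ x + e_i`; needs `d ≥ 1`, witnessed
  by an index `i : Fin d`). [cite: DysonLiebSimon1978, §2]
* **§4 Torus rows.** `S^α_tot ψ = 0` on the ground space of `heisenbergTorus d L n J`, `J > 0`,
  `2 ∣ L` (`heisenbergTorus_totalSpin_mulVec_eq_zero_of_mem_groundSpace`); by-products: the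
  even-torus antiferromagnet has a UNIQUE ground state, lying in the `Sᶻ_tot = 0` sector
  (`heisenbergTorus_hasUniqueGroundState_of_even`, `heisenbergTorus_groundSpace_le_spinZSector_zero`),
  unconditionally — the cell's symmetric / sector certificates may cite these instead of a
  numerically certified gap; and the `m_s²(L)` rows of `R2-TABLE` §A with singlet null terms
  (`neelOrderParamSq_ge/le_of_windowCertificate_singlet`, same shape as the tree's
  `neelOrderParamSq_ge/le_of_windowCertificate` plus the extra null family).

No certificate is contained here; these are soundness edges. References: Lieb–Mattis (1962) Thm 2
[cite: LiebMattis1962, Theorem 2]; Dyson–Lieb–Simon (1978) §2 (the bipartite torus setting)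
[cite: DysonLiebSimon1978, §2]; Kull et al. (2024) §5.3 / Wang et al. (2024) §3 eq. (4)
(Heisenberg bootstrap certificates) [cite: KullEtAl2024, §5.3] [cite: WangEtAl2024].
-/


namespace Summit.HubbardSuperconductivity.HubbardLadder

open Matrix Finset Filter Literature.Probability.LatticeModels
  Literature.MathematicalPhysics.QuantumLattice
  Literature.MathematicalPhysics.QuantumManyBody.StateRelaxation
open scoped ComplexOrder

noncomputable section

/-! ## §3 The even torus: see `Literature.Probability.LatticeModels.TorusBipartite` (imported). -/

/-! ## §4 Singlet rows on the even two-dimensional torus (the `m_s²(L)` rows of R2-TABLE §A) -/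

section TorusRows

variable {m : Type*} [Fintype m] [DecidableEq m]

/-- **`S^α_tot` annihilates the Heisenberg ground space on the even torus** `(ℤ/Lℤ)^d`, `2 ∣ L`,
`d ≥ 1`, `J > 0` (Lieb–Mattis on the connected bipartite balanced torus).
[cite: LiebMattis1962, Theorem 2] -/
theorem heisenbergTorus_totalSpin_mulVec_eq_zero_of_mem_groundSpace {d : ℕ} (i : Fin d) (L : ℕ)
    [NeZero L] (hL : 2 ∣ L) (n : ℕ) {J : ℝ} (hJ : 0 < J)
    {ψ : TensorIndex (TorusSite d L) (n + 1) → ℂ}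
    (hψ : ψ ∈ (heisenbergTorus d L n J).groundSpace) (α : Fin 3) :
    totalSpin (Λ := TorusSite d L) n α *ᵥ ψ = 0 :=
  totalSpin_mulVec_eq_zero_of_mem_groundSpace n (torusGraph d L) (evenSublattice (d := d) L hL) J
    (torusGraph_connected_of_proj d L) (torusGraph_isBipartiteWith_evenSublattice L hL) hJ
    (card_compl_evenSublattice L hL i) hψ α

/-- **The Heisenberg antiferromagnet on the even torus has a unique ground state** (`(ℤ/Lℤ)^d`,
`2 ∣ L`, `d ≥ 1`, `J > 0`, any spin `n/2`): Lieb–Mattis `2S₀ + 1 = 1` on the connected bipartite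
balanced torus (`LiebMattis.hasUniqueGroundState_of_card_compl_eq`). [cite: LiebMattis1962, Theorem 2] -/
theorem heisenbergTorus_hasUniqueGroundState_of_even {d : ℕ} (i : Fin d) (L : ℕ) [NeZero L]
    (hL : 2 ∣ L) (n : ℕ) {J : ℝ} (hJ : 0 < J) : (heisenbergTorus d L n J).HasUniqueGroundState :=
  LiebMattis.hasUniqueGroundState_of_card_compl_eq n (torusGraph d L) (evenSublattice (d := d) L hL)
    J (torusGraph_connected_of_proj d L) (torusGraph_isBipartiteWith_evenSublattice L hL) hJ
    (card_compl_evenSublattice L hL i)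

/-- **The ground space of the even-torus antiferromagnet lies in the `Sᶻ_tot = 0` sector**
(`LiebMattis.groundSpace_le_spinZSector_zero` on the torus). [cite: LiebMattis1962, Theorem 2] -/
theorem heisenbergTorus_groundSpace_le_spinZSector_zero {d : ℕ} (i : Fin d) (L : ℕ) [NeZero L]
    (hL : 2 ∣ L) (n : ℕ) {J : ℝ} (hJ : 0 < J) :
    (heisenbergTorus d L n J).groundSpace ≤ spinZSector (Λ := TorusSite d L) n 0 :=
  LiebMattis.groundSpace_le_spinZSector_zero n (torusGraph d L) (evenSublattice (d := d) L hL) J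
    (torusGraph_connected_of_proj d L) (torusGraph_isBipartiteWith_evenSublattice L hL) hJ
    (card_compl_evenSublattice L hL i)

/-- **Window certificate with singlet rows ⇒ certified LOWER bound on `m_s²(L)`**, `L` even,
`J > 0`: as `neelOrderParamSq_ge_of_windowCertificate` with the additional null family
`Σ_q (P_q S^{a q}_tot + S^{a' q}_tot Q_q)`. [cite: WangEtAl2024, §3 eq. (4)]
[cite: LiebMattis1962, Theorem 2] -/
theorem neelOrderParamSq_ge_of_windowCertificate_singlet (k : ℕ) (hk : 2 ∣ k + 1) {J : ℝ}
    (hJ : 0 < J) {Λ : Matrix m m ℂ} (hΛ : Λ.PosSemidef) (O : m → Op (TorusSite 2 (k + 1)) 2)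
    {κ : Type*} (s : Finset κ) (X : κ → Op (TorusSite 2 (k + 1)) 2)
    {ι : Type*} (t : Finset ι) (U Y : ι → Op (TorusSite 2 (k + 1)) 2)
    (hU : ∀ l ∈ t, U l * heisenbergTorus 2 (k + 1) 1 J = heisenbergTorus 2 (k + 1) 1 J * U l)
    (hUU : ∀ l ∈ t, (U l)ᴴ * U l = 1)
    {ι' : Type*} (t' : Finset ι') (P Q : ι' → Op (TorusSite 2 (k + 1)) 2) (a a' : ι' → Fin 3)
    {Eup μ c : ℝ} (hμ : 0 ≤ μ) (hE : (heisenbergTorus 2 (k + 1) 1 J).groundEnergy ≤ Eup)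
    (hcert : stagStructureOp (k + 1) 1 - (c : ℂ) • 1 =
      gramForm Λ O +
        (∑ b ∈ s, (heisenbergTorus 2 (k + 1) 1 J * X b - X b * heisenbergTorus 2 (k + 1) 1 J) +
            ∑ l ∈ t, (U l * Y l * (U l)ᴴ - Y l) +
          ∑ q ∈ t', (P q * totalSpin 1 (a q) + totalSpin 1 (a' q) * Q q)) +
        (μ : ℂ) • ((Eup : ℂ) • 1 - heisenbergTorus 2 (k + 1) 1 J)) :
    c / ((k + 1 : ℕ) : ℝ) ^ 4 ≤ neelOrderParamSq (k + 1) J := by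
  rw [neelOrderParamSq_succ_eq_re_groundStateFunctional]
  exact div_le_div_of_nonneg_right
    (re_groundStateFunctional_ge_of_windowCertificate_singlet 1 (torusGraph 2 (k + 1))
      (evenSublattice (d := 2) (k + 1) hk) J (torusGraph_connected_of_proj 2 (k + 1))
      (torusGraph_isBipartiteWith_evenSublattice (k + 1) hk) hJ
      (card_compl_evenSublattice (k + 1) hk 0) hΛ O s X t U Y hU hUU t' P Q a a' hμ hE hcert)
    (by positivity)

/-- **Window certificate with singlet rows ⇒ certified UPPER bound on `m_s²(L)`**, `L` even,
`J > 0` (certificate for `-𝓢`). [cite: WangEtAl2024, §3 eq. (4)] [cite: LiebMattis1962, Theorem 2] -/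
theorem neelOrderParamSq_le_of_windowCertificate_singlet (k : ℕ) (hk : 2 ∣ k + 1) {J : ℝ}
    (hJ : 0 < J) {Λ : Matrix m m ℂ} (hΛ : Λ.PosSemidef) (O : m → Op (TorusSite 2 (k + 1)) 2)
    {κ : Type*} (s : Finset κ) (X : κ → Op (TorusSite 2 (k + 1)) 2)
    {ι : Type*} (t : Finset ι) (U Y : ι → Op (TorusSite 2 (k + 1)) 2)
    (hU : ∀ l ∈ t, U l * heisenbergTorus 2 (k + 1) 1 J = heisenbergTorus 2 (k + 1) 1 J * U l)
    (hUU : ∀ l ∈ t, (U l)ᴴ * U l = 1)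
    {ι' : Type*} (t' : Finset ι') (P Q : ι' → Op (TorusSite 2 (k + 1)) 2) (a a' : ι' → Fin 3)
    {Eup μ c : ℝ} (hμ : 0 ≤ μ) (hE : (heisenbergTorus 2 (k + 1) 1 J).groundEnergy ≤ Eup)
    (hcert : -stagStructureOp (k + 1) 1 - (c : ℂ) • 1 =
      gramForm Λ O +
        (∑ b ∈ s, (heisenbergTorus 2 (k + 1) 1 J * X b - X b * heisenbergTorus 2 (k + 1) 1 J) +
            ∑ l ∈ t, (U l * Y l * (U l)ᴴ - Y l) +
          ∑ q ∈ t', (P q * totalSpin 1 (a q) + totalSpin 1 (a' q) * Q q)) +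
        (μ : ℂ) • ((Eup : ℂ) • 1 - heisenbergTorus 2 (k + 1) 1 J)) :
    neelOrderParamSq (k + 1) J ≤ -c / ((k + 1 : ℕ) : ℝ) ^ 4 := by
  rw [neelOrderParamSq_succ_eq_re_groundStateFunctional]
  exact div_le_div_of_nonneg_right
    (re_groundStateFunctional_le_of_windowCertificate_singlet 1 (torusGraph 2 (k + 1))
      (evenSublattice (d := 2) (k + 1) hk) J (torusGraph_connected_of_proj 2 (k + 1))
      (torusGraph_isBipartiteWith_evenSublattice (k + 1) hk) hJ
      (card_compl_evenSublattice (k + 1) hk 0) hΛ O s X t U Y hU hUU t' P Q a a' hμ hE hcert)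
    (by positivity)

end TorusRows

end

end Summit.HubbardSuperconductivity.HubbardLadder
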